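import Mathlib
import HarnessLib

/-!
# Unisolvent points: a linearly independent finite family of functions has an invertible evaluation matrix

**Lemma (Cheney, *Introduction to Approximation Theory*, Ch. 3, Problem 23).** Functions `f_1, …, f_n : X → K` (any field `K`,
any set `X`) are linearly independent iff there are points `x_1, …, x_n ∈ X` with `det [f_j(x_i)] ≠ 0`.  Proof (as hinted
there): induction on `n`; given points for `f_2, …, f_n`, expand `t ↦ det [f_j(x_i)]` (first point `t` variable) along its
first row: it is `Σ_j λ_j f_j(t)` with `λ_1 = ± det` of the smaller matrix `≠ 0`, so by independence it is not identically `0`.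

Consequence used for «coefficient extraction by point evaluations» (no integration needed): if `F = Σ_j c_j f_j` then
`c = M⁻¹ · (F(x_i))_i` with the evaluation matrix `M = [f_j(x_i)]` — the coefficients of a function in a fixed finite
basis are FIXED linear combinations of finitely many point values.

Main results: `exists_det_eval_ne_zero_of_linearIndependent`, `linearIndependent_of_det_eval_ne_zero`,
`linearIndependent_iff_exists_det_eval_ne_zero`, `eq_inv_mulVec_eval_of_sum_smul`.
-/

namespace Literature.LinearAlgebra

open Matrix
open scoped BigOperators

section Unisolvent

variable {K : Type*} {X : Type*}

/-- The evaluation matrix `M_{ij} = f_j(x_i)` of a family of functions at a family of points. [cite: Cheney1982, Ch. 3 Problem 23] -/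
def evalMatrix {n : ℕ} (f : Fin n → X → K) (x : Fin n → X) : Matrix (Fin n) (Fin n) K :=
  Matrix.of fun i j => f j (x i)

/-- Entries of the evaluation matrix. [cite: Cheney1982, Ch. 3 Problem 23] -/
@[simp] theorem evalMatrix_apply {n : ℕ} (f : Fin n → X → K) (x : Fin n → X) (i j : Fin n) :
    evalMatrix f x i j = f j (x i) := rfl

variable [Field K]

/-- `M · c` is the vector of values of `Σ_j c_j f_j` at the points. [cite: Cheney1982, Ch. 3 Problem 23] -/
theorem evalMatrix_mulVec {n : ℕ} (f : Fin n → X → K) (x : Fin n → X) (c : Fin n → K) :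
    (evalMatrix f x).mulVec c = fun i => ∑ j, c j * f j (x i) := by
  ext i
  simp [Matrix.mulVec, dotProduct, mul_comm]

/-- **Unisolvent points exist** (Cheney, Ch. 3, Problem 23): for a linearly independent family `f : Fin n → (X → K)` of
functions there are points `x : Fin n → X` with `det [f_j(x_i)] ≠ 0`. [cite: Cheney1982, Ch. 3 Problem 23] -/
theorem exists_det_eval_ne_zero_of_linearIndependent :
    ∀ {n : ℕ} {f : Fin n → X → K}, LinearIndependent K f → ∃ x : Fin n → X, (evalMatrix f x).det ≠ 0 := by
  intro n
  induction n with
  | zero =>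
    intro f _
    exact ⟨Fin.elim0, by simp [Matrix.det_fin_zero]⟩
  | succ n ih =>
    intro f hf
    -- points for the tail family `f ∘ Fin.succ`
    have htail : LinearIndependent K (f ∘ Fin.succ) := hf.comp Fin.succ (Fin.succ_injective n)
    obtain ⟨y, hy⟩ := ih htail
    -- the cofactors of the expansion along the new (first) row
    set lam : Fin (n + 1) → K := fun j =>
      (-1 : K) ^ (j : ℕ) * (Matrix.of fun i' j' => f (j.succAbove j') (y i')).det with hlam
    -- the expansion: `det (evalMatrix f (Fin.cons t y)) = Σ_j lam_j f_j(t)`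
    have hexp : ∀ t : X, (evalMatrix f (Fin.cons t y)).det = ∑ j, lam j * f j t := by
      intro t
      rw [Matrix.det_succ_row_zero]
      refine Finset.sum_congr rfl fun j _ => ?_
      have hsub : (evalMatrix f (Fin.cons t y)).submatrix Fin.succ j.succAbove =
          Matrix.of fun i' j' => f (j.succAbove j') (y i') := by
        ext i' j'
        simp [evalMatrix, Matrix.submatrix]
      rw [hsub, hlam]
      simp only [evalMatrix_apply, Fin.cons_zero]
      ring
    -- the leading cofactor is `det` of the tail evaluation matrix, hence `≠ 0`
    have hlam0 : lam 0 ≠ 0 := by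
      rw [hlam]
      simp only [Fin.val_zero, pow_zero, one_mul, Fin.succAbove_zero]
      exact hy
    -- if the determinant vanished for every new point, `Σ lam_j f_j = 0` would contradict independence
    by_contra hcon
    push Not at hcon
    have hzero : ∑ j, lam j • f j = 0 := by
      funext t
      simp only [Finset.sum_apply, Pi.smul_apply, smul_eq_mul, Pi.zero_apply]
      rw [← hexp t]
      exact hcon (Fin.cons t y)
    exact hlam0 (Fintype.linearIndependent_iff.1 hf lam hzero 0)

/-- The easy converse: an invertible evaluation matrix forces linear independence. [cite: Cheney1982, Ch. 3 Problem 23] -/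
theorem linearIndependent_of_det_eval_ne_zero {n : ℕ} {f : Fin n → X → K} {x : Fin n → X}
    (hx : (evalMatrix f x).det ≠ 0) : LinearIndependent K f := by
  rw [Fintype.linearIndependent_iff]
  intro c hc
  have hMc : (evalMatrix f x).mulVec c = 0 := by
    rw [evalMatrix_mulVec]
    funext i
    have := congrFun hc (x i)
    simpa [Finset.sum_apply, Pi.smul_apply, smul_eq_mul] using this
  have hc0 : c = 0 := by
    have h := congrArg ((evalMatrix f x)⁻¹.mulVec) hMc
    rwa [Matrix.mulVec_mulVec, Matrix.nonsing_inv_mul _ (isUnit_iff_ne_zero.2 hx), Matrix.one_mulVec,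
      Matrix.mulVec_zero] at h
  exact fun i => congrFun hc0 i

/-- **Cheney Ch. 3 Problem 23** as an `iff`. [cite: Cheney1982, Ch. 3 Problem 23] -/
theorem linearIndependent_iff_exists_det_eval_ne_zero {n : ℕ} {f : Fin n → X → K} :
    LinearIndependent K f ↔ ∃ x : Fin n → X, (evalMatrix f x).det ≠ 0 :=
  ⟨exists_det_eval_ne_zero_of_linearIndependent, fun ⟨_, hx⟩ => linearIndependent_of_det_eval_ne_zero hx⟩

/-- **Coefficient extraction by point evaluations**: with an invertible evaluation matrix `M = [f_j(x_i)]`, the coefficients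
of `F = Σ_j c_j f_j` are `c = M⁻¹ · (F(x_i))_i`. [cite: Cheney1982, Ch. 3 Problem 23] -/
theorem eq_inv_mulVec_eval_of_sum_smul {n : ℕ} {f : Fin n → X → K} {x : Fin n → X}
    (hx : (evalMatrix f x).det ≠ 0) (c : Fin n → K) :
    c = (evalMatrix f x)⁻¹.mulVec fun i => ∑ j, c j * f j (x i) := by
  rw [← evalMatrix_mulVec, Matrix.mulVec_mulVec, Matrix.nonsing_inv_mul _ (isUnit_iff_ne_zero.2 hx),
    Matrix.one_mulVec]

/-- Pointwise form of the extraction: `c_k = Σ_i (M⁻¹)_{ki} F(x_i)` for `F = Σ_j c_j f_j`. [cite: Cheney1982, Ch. 3 Problem 23] -/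
theorem coeff_eq_sum_inv_mul_eval {n : ℕ} {f : Fin n → X → K} {x : Fin n → X}
    (hx : (evalMatrix f x).det ≠ 0) (c : Fin n → K) (k : Fin n) :
    c k = ∑ i, (evalMatrix f x)⁻¹ k i * ∑ j, c j * f j (x i) := by
  conv_lhs => rw [eq_inv_mulVec_eval_of_sum_smul hx c]
  simp [Matrix.mulVec, dotProduct]

end Unisolvent

/-! ## Families depending on a parameter: the coefficients inherit continuity and bounds from point values -/

section Parametric

variable {X : Type*}

/-- **Coefficients of a parametrised combination are fixed linear combinations of point values**: if
`F r = Σ_j c_j(r) f_j` (as functions on `X`) for every parameter `r`, and `M = [f_j(x_i)]` is invertible, then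
`c_k(r) = Σ_i (M⁻¹)_{ki} F r (x_i)`. [cite: Cheney1982, Ch. 3 Problem 23] -/
theorem coeff_eq_sum_inv_mul_apply {K : Type*} [Field K] {n : ℕ} {f : Fin n → X → K} {x : Fin n → X}
    (hx : (evalMatrix f x).det ≠ 0) {T : Type*} (c : T → Fin n → K) (F : T → X → K)
    (hF : ∀ r y, F r y = ∑ j, c r j * f j y) (r : T) (k : Fin n) :
    c r k = ∑ i, (evalMatrix f x)⁻¹ k i * F r (x i) := by
  rw [coeff_eq_sum_inv_mul_eval hx (c r) k]
  simp only [hF]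

/-- **Continuity transfer**: if each point value `r ↦ F r (x_i)` is continuous (within a set `s`), so is every coefficient
`r ↦ c_k(r)`. [cite: Cheney1982, Ch. 3 Problem 23] -/
theorem continuousWithinAt_coeff {n : ℕ} {f : Fin n → X → ℝ} {x : Fin n → X} (hx : (evalMatrix f x).det ≠ 0)
    {T : Type*} [TopologicalSpace T] (c : T → Fin n → ℝ) (F : T → X → ℝ)
    (hF : ∀ r y, F r y = ∑ j, c r j * f j y) {s : Set T} {r₀ : T}
    (hcont : ∀ i, ContinuousWithinAt (fun r => F r (x i)) s r₀) (k : Fin n) :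
    ContinuousWithinAt (fun r => c r k) s r₀ := by
  have hfun : (fun r => c r k) = fun r => ∑ i, (evalMatrix f x)⁻¹ k i * F r (x i) :=
    funext fun r => coeff_eq_sum_inv_mul_apply hx c F hF r k
  rw [hfun]
  exact tendsto_finsetSum _ fun i _ => (hcont i).tendsto.const_mul ((evalMatrix f x)⁻¹ k i)

/-- **Bound transfer**: if `|F r (y)| ≤ g(r)` at the chosen points, then `|c_k(r)| ≤ (Σ_i |(M⁻¹)_{ki}|) · g(r)`.
[cite: Cheney1982, Ch. 3 Problem 23] -/
theorem abs_coeff_le {n : ℕ} {f : Fin n → X → ℝ} {x : Fin n → X} (hx : (evalMatrix f x).det ≠ 0)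
    {T : Type*} (c : T → Fin n → ℝ) (F : T → X → ℝ) (hF : ∀ r y, F r y = ∑ j, c r j * f j y)
    {g : T → ℝ} {r : T} (hg : ∀ i, |F r (x i)| ≤ g r) (k : Fin n) :
    |c r k| ≤ (∑ i, |(evalMatrix f x)⁻¹ k i|) * g r := by
  rw [coeff_eq_sum_inv_mul_apply hx c F hF r k, Finset.sum_mul]
  refine (Finset.abs_sum_le_sum_abs _ _).trans (Finset.sum_le_sum fun i _ => ?_)
  rw [abs_mul]
  exact mul_le_mul_of_nonneg_left (hg i) (abs_nonneg _)

end Parametric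

end Literature.LinearAlgebra
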